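import Literature.NumberTheory.GaloisRepresentations.EisensteinSexticPrimes
import Mathlib.NumberTheory.LegendreSymbol.JacobiSymbol
import HarnessLib

/-!
# The Größencharakter `𝔭 ↦ (k/N𝔭)·(4k/𝔭)₃·ϖ_𝔭` of `ℚ(ω)` modulo `(36k)` — the ideal-theoretic Hecke character of the sextic twists
# `E^k : y² = x³ + k` (Ireland–Rosen Ch. 18, Theorems 4 and 7)

Topic `Literature/NumberTheory/GaloisRepresentations`, namespace `Literature.NumberTheory.GaloisRepresentations.EisensteinSextic` (sequel of
`EisensteinSexticPrimes`).  Definitions with bodies (`modulus`, `psi`) and THEOREMS; no instance, no notation, no named fact.  The `j = 0`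
member of the family `OmegaPrimeGrossencharakter` (the six Gross classes) / `SqrtNegTwoGrossencharakter` (`j = 8000`): for an abstract `K ∋ ζ₃`
(`{ζ : 𝓞 K} (hζ : IsPrimitiveRoot ζ 3)`, `IsCyclotomicExtension {3} ℚ K`), an integer `k ≠ 0` and an embedding `e : K → ℂ`, the function

  `psi hζ k e v = [6k ∈ 𝔭_v ↦ 0] · (k / N𝔭_v) · e((4k/𝔭_v)₃) · e(ϖ_v)`

on the primes of `𝓞 K` (`(k/·)` the Jacobi symbol, `(·/𝔭)₃ = cubicResidueSymbol 𝔭` read in `ℂˣ` through `cubicLoc`, `ϖ_v ≡ 1 (mod 3)` the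
primary generator) — the weight-one character «`χ(𝔭) = −\overline{(4D/π)}₆ π`» of Ireland–Rosen's Theorems 18.4/18.7 for `y² = x³ + D`, in the
form `(k/p)(4k/𝔭)₃ ϖ` of the tree's `SexticTwist.lFunction_apply_prime_split`:

* `modulus k = (36k)`, `modulus_le_iff` (`(36k) ∣ 𝔭 ↔ 6k ∈ 𝔭`), `gcd_absNorm_eq_one`; `psi`, `psi_ne_zero`;
* `idealPow_jacobiSym` (`∏ (k/N𝔭)^{ν_𝔭(𝔞)} = (k/N𝔞)`), ★ `idealPow_psi_span` (`ψ̃((b)) = (k/N(b))·S((b))·e(primarize b)`, `S = artinSymbol cubicLoc`);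
* ★★ `isGrossencharakter_psi : IsGrossencharakter (36k) (embType e) (embTypeConj e) (psi hζ k e)` (`k ≠ 0`; quadratic part: congruent
  elements have congruent ODD norms + `jacobiSym.mod_right`; cubic part: periodicity modulo `9·4k`; generator part: one unit primarises `b` and
  `c`) and its literal type-`(1,0)` form `isGrossencharakter_psi_one_zero` — clause (i) of `Deuring_exists_heckeCharacter_of_maximalCM` on the
  row `j = 0` up to `heckeOfGross`;
* ★ `psi_smul_eq_conj : ψ(c • 𝔭) = conj ψ(𝔭)` for the non-trivial automorphism `c` and every `𝔭` (clause (ii), prime by prime).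

The Frobenius matching against `a_p(E^k)` and the packaged datum are in `EllipticCurves/SexticTwistGrossencharakterFrobenius`.
Nothing about BSD is proved here; no modularity is used.

## References
* K. Ireland, M. Rosen, *A Classical Introduction to Modern Number Theory*, 2nd ed., GTM 84 (1990), Ch. 18 §3 Theorem 4, §6 Theorem 7
  («`χ` is a Hecke character of weight one with conductor dividing `12D`»), §7. [IrelandRosen1990]
* J. Neukirch, *Algebraic Number Theory* (1999), Ch. VII §6 Def. (6.1), Cor. (6.14). [NeukirchANT1999]
* J. H. Silverman, *Advanced Topics in the Arithmetic of Elliptic Curves* (1994), II Thm. 9.2, Thm. 10.5, Ex. 2.33. [SilvermanATAEC1994]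

## Mathlib / tree search
Tree: `EisensteinSexticPrimes` (§§0–2: `cubicLoc`, `varpi`, `hsurj_three`, `hinj_three`, `absNorm_span_modEq`, `not_dvd_absNorm_of_isCoprime`,
`coe_cubicLoc_smul`, `embedding_varpi_smul`, `intCast_mem_smul_iff`, `smul_intCast`, `subsingleton_infinitePlace`); `idealPow_primaryGen_span`,
`primarize_mul_eq_primarize_mul`, `embType`, `embTypeConj`, `prod_embedding_zpow_embType` (`PrimaryGeneratorHeckeCharacter`); `IsGrossencharakter`
(`GrossencharakterIdeleValue`); `LFunctions.{idealPow, idealPow_finsuppProd, mem_range_finsuppProd_asIdeal_pow_iff, isCoprime_span_of_sub_mem,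
isCoprime_iff_forall_not_le, mulSupport_idealPow_finite}`, `LFunctions.AbelianDensity.idealPow_comp_eq`; `RayClassOfIdealHom.idealPow_congr_of_isCoprime`
and `CubicRayClassCharacterCount.idealPow_mul_fun` (copied privately, not imported).  Mathlib: `jacobiSym.{mod_right, eq_zero_iff, mul_right',
pow_right, one_right}`, `map_finsuppProd`, `Int.sign_mul_abs`.
-/

noncomputable section

open NumberField IsDedekindDomain IsDedekindDomain.HeightOneSpectrum
open scoped NumberTheorySymbols ComplexConjugate Pointwise

namespace Literature.NumberTheory.GaloisRepresentations.EisensteinSextic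

open Literature.NumberTheory.GaloisRepresentations
open Literature.NumberTheory.LFunctions (idealPow isCoprime_span_of_sub_mem)
open Literature.NumberTheory.LFunctions.AbelianDensity (artinSymbol artinSymbol_asIdeal idealPow_comp_eq)
open Literature.NumberTheory.Automorphic (RingOfIntegers.coe_algEquiv_smul HeightOneSpectrum.smul_mem_smul_asIdeal_iff)

variable {K : Type*} [Field K] [NumberField K] {ζ : 𝓞 K} (hζ : IsPrimitiveRoot ζ 3)

/-! ### §3 The character `ψ(𝔭) = (k/N𝔭)·(4k/𝔭)₃·ϖ_𝔭` and its Größencharakter property modulo `(36k)` -/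

section Modulus

/-- The modulus `(36k)` («conductor dividing `12D`», up to the factor `3` of the tree's `9D`-periodicity). [cite: IrelandRosen1990, Ch. 18 §6 Theorem 7] -/
def modulus (k : ℤ) : Ideal (𝓞 K) := Ideal.span {((36 * k : ℤ) : 𝓞 K)}

/-- `(36k) ≠ 0` for `k ≠ 0`. [cite: IrelandRosen1990, Ch. 18 §6 Theorem 7] -/
theorem modulus_ne_bot {k : ℤ} (hk : k ≠ 0) : modulus (K := K) k ≠ ⊥ := by
  rw [modulus, Ne, Ideal.span_singleton_eq_bot]
  exact_mod_cast (mul_ne_zero (by norm_num : (36 : ℤ) ≠ 0) hk)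

omit [NumberField K] in
/-- `6k ∉ 𝔭 ⇒ 2 ∉ 𝔭, 3 ∉ 𝔭, 4k ∉ 𝔭`. [cite: IrelandRosen1990, Ch. 18 §7 («`P ∤ 6D`»)] -/
theorem not_mem_of_six_mul_not_mem {k : ℤ} {v : HeightOneSpectrum (𝓞 K)} (h : ((6 * k : ℤ) : 𝓞 K) ∉ v.asIdeal) :
    (2 : 𝓞 K) ∉ v.asIdeal ∧ (3 : 𝓞 K) ∉ v.asIdeal ∧ ((4 * k : ℤ) : 𝓞 K) ∉ v.asIdeal := by
  have e2 : ((6 * k : ℤ) : 𝓞 K) = 2 * ((3 * k : ℤ) : 𝓞 K) := by push_cast; ring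
  have e3 : ((6 * k : ℤ) : 𝓞 K) = 3 * ((2 * k : ℤ) : 𝓞 K) := by push_cast; ring
  refine ⟨fun h2 => h ?_, fun h3 => h ?_, fun h4 => h ?_⟩
  · rw [e2]; exact v.asIdeal.mul_mem_right _ h2
  · rw [e3]; exact v.asIdeal.mul_mem_right _ h3
  · have h4' : (2 : 𝓞 K) * ((2 * k : ℤ) : 𝓞 K) ∈ v.asIdeal := by
      have : ((4 * k : ℤ) : 𝓞 K) = 2 * ((2 * k : ℤ) : 𝓞 K) := by push_cast; ring
      rwa [this] at h4
    rcases v.isPrime.mem_or_mem h4' with h2 | h2k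
    · rw [e2]; exact v.asIdeal.mul_mem_right _ h2
    · rw [e3]; exact v.asIdeal.mul_mem_left _ h2k

omit [NumberField K] in
/-- **`(36k) ∣ 𝔭 ↔ 6k ∈ 𝔭`** (the modulus is supported on the primes of `6k`). [cite: IrelandRosen1990, Ch. 18 §6 Theorem 7] -/
theorem modulus_le_iff (k : ℤ) (v : HeightOneSpectrum (𝓞 K)) : modulus k ≤ v.asIdeal ↔ ((6 * k : ℤ) : 𝓞 K) ∈ v.asIdeal := by
  rw [modulus, Ideal.span_singleton_le_iff_mem]
  have e6 : ((36 * k : ℤ) : 𝓞 K) = 6 * ((6 * k : ℤ) : 𝓞 K) := by push_cast; ring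
  constructor
  · intro h
    rw [e6] at h
    rcases v.isPrime.mem_or_mem h with h6 | h6k
    · by_contra hne
      obtain ⟨h2, h3, -⟩ := not_mem_of_six_mul_not_mem hne
      have h6' : (2 : 𝓞 K) * 3 ∈ v.asIdeal := by rw [show (2 : 𝓞 K) * 3 = 6 by norm_num]; exact h6
      rcases v.isPrime.mem_or_mem h6' with h | h
      · exact h2 h
      · exact h3 h
    · exact h6k
  · intro h
    rw [e6]; exact v.asIdeal.mul_mem_left _ h

end Modulus

section Psi

variable [IsCyclotomicExtension {3} ℚ K]

open Classical in
/-- ★ **The ideal-theoretic Hecke character of `E^k : y² = x³ + k`** on the primes of `K = ℚ(ω)`: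
`ψ(𝔭_v) = (k/N𝔭_v) · e((4k/𝔭_v)₃) · e(ϖ_v)` for `6k ∉ 𝔭_v`, and `0` at the primes of `6k` (Ireland–Rosen Thm. 18.4:
«`N_p = p + 1 + \overline{(4D/π)}₆π + (4D/π)₆π̄`», `−\overline{(4D/π)₆}π = (D/p)(4D/𝔭)₃ϖ` with `ϖ = −π ≡ 1 (3)`).
[cite: IrelandRosen1990, Ch. 18 §3 Theorem 4, §7] -/
def psi (k : ℤ) (e : K →+* ℂ) (v : HeightOneSpectrum (𝓞 K)) : ℂ :=
  if ((6 * k : ℤ) : 𝓞 K) ∈ v.asIdeal then 0 else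
    (J(k | Ideal.absNorm v.asIdeal) : ℂ) * (cubicLoc hζ ((4 * k : ℤ) : 𝓞 K) e v : ℂ) * e (varpi hζ v : K)

/-- `ψ(𝔭) = 0` at the primes of `6k`. [cite: IrelandRosen1990, Ch. 18 §7 («if `P ∣ 6D` then `χ(P) = 0`»)] -/
theorem psi_of_mem {k : ℤ} (e : K →+* ℂ) {v : HeightOneSpectrum (𝓞 K)} (h : ((6 * k : ℤ) : 𝓞 K) ∈ v.asIdeal) : psi hζ k e v = 0 := by
  rw [psi, if_pos h]

/-- `ψ(𝔭) = (k/N𝔭)·(4k/𝔭)₃·ϖ_𝔭` off `6k`. [cite: IrelandRosen1990, Ch. 18 §3 Theorem 4] -/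
theorem psi_of_not_mem {k : ℤ} (e : K →+* ℂ) {v : HeightOneSpectrum (𝓞 K)} (h : ((6 * k : ℤ) : 𝓞 K) ∉ v.asIdeal) :
    psi hζ k e v = (J(k | Ideal.absNorm v.asIdeal) : ℂ) * (cubicLoc hζ ((4 * k : ℤ) : 𝓞 K) e v : ℂ) * e (varpi hζ v : K) := by
  rw [psi, if_neg h]

/-- ★ **`ψ(𝔭) ≠ 0` off `6k`** (`(k, N𝔭) = 1`, the cubic value is a unit, `ϖ_𝔭 ≠ 0`). [cite: IrelandRosen1990, Ch. 18 §7] -/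
theorem psi_ne_zero {k : ℤ} (e : K →+* ℂ) {v : HeightOneSpectrum (𝓞 K)} (h : ((6 * k : ℤ) : 𝓞 K) ∉ v.asIdeal) :
    psi hζ k e v ≠ 0 := by
  obtain ⟨-, h3, -⟩ := not_mem_of_six_mul_not_mem h
  rw [psi_of_not_mem hζ e h]
  refine mul_ne_zero (mul_ne_zero ?_ (Units.ne_zero _)) ?_
  · have hJ : J(k | Ideal.absNorm v.asIdeal) ≠ 0 := fun h0 => (jacobiSym.eq_zero_iff.mp h0).2 (gcd_absNorm_eq_one h)
    exact_mod_cast hJ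
  · rw [map_ne_zero]
    exact fun h0 => varpi_ne_zero hζ h3 (by exact_mod_cast h0)

omit [IsCyclotomicExtension {3} ℚ K] in
/-- The Jacobi symbol of a finite product of nonzero naturals. [folklore] -/
private theorem jacobiSym_prod_right (a : ℤ) {ι : Type*} (s : Finset ι) (f : ι → ℕ) (hf : ∀ i ∈ s, f i ≠ 0) :
    J(a | ∏ i ∈ s, f i) = ∏ i ∈ s, J(a | f i) := by
  induction s using Finset.cons_induction with
  | empty => simp [jacobiSym.one_right]
  | cons i s hi ih =>
    rw [Finset.prod_cons, Finset.prod_cons,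
      jacobiSym.mul_right' a (hf i (Finset.mem_cons_self i s))
        (Finset.prod_ne_zero_iff.mpr fun j hj => hf j (Finset.mem_cons_of_mem hj)),
      ih fun j hj => hf j (Finset.mem_cons_of_mem hj)]

omit [IsCyclotomicExtension {3} ℚ K] in
/-- **`∏_𝔭 (k/N𝔭)^{ν_𝔭(𝔞)} = (k/N𝔞)`** (multiplicativity of `N` and of the Jacobi symbol in its lower argument). [cite: IrelandRosen1990, Ch. 18 §6, proof of Theorem 7 (`χ` on `A = ∏ P^{a(P)}`)] -/
theorem idealPow_jacobiSym (k : ℤ) {I : Ideal (𝓞 K)} (hI : I ≠ ⊥) :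
    idealPow K (fun v ↦ (J(k | Ideal.absNorm v.asIdeal) : ℂ)) I = (J(k | Ideal.absNorm I) : ℂ) := by
  obtain ⟨g, rfl⟩ := (LFunctions.mem_range_finsuppProd_asIdeal_pow_iff (I := I)).mpr hI
  rw [LFunctions.idealPow_finsuppProd, map_finsuppProd Ideal.absNorm]
  simp only [map_pow]
  unfold Finsupp.prod
  rw [jacobiSym_prod_right k _ _ (fun v _ => pow_ne_zero _ (by rw [Ne, Ideal.absNorm_eq_zero_iff]; exact v.ne_bot))]
  push_cast
  simp only [jacobiSym.pow_right, Int.cast_pow]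

omit [IsCyclotomicExtension {3} ℚ K] in
/-- `idealPow` on an ideal prime to `𝔪` only sees the values off `𝔪` (copy of `RayClassOfIdealHom.idealPow_congr_of_isCoprime`, not imported). [folklore] -/
private theorem idealPow_congr_of_isCoprime' {𝔪 : Ideal (𝓞 K)} (h𝔪 : 𝔪 ≠ ⊥) {ψ ψ' : HeightOneSpectrum (𝓞 K) → ℂ}
    (h : ∀ v : HeightOneSpectrum (𝓞 K), ¬ 𝔪 ≤ v.asIdeal → ψ v = ψ' v) {I : Ideal (𝓞 K)} (hI : I ≠ ⊥)
    (hIm : IsCoprime I 𝔪) : idealPow K ψ I = idealPow K ψ' I := by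
  unfold idealPow
  refine finprod_congr fun v => ?_
  by_cases hc : (Associates.mk v.asIdeal).count (Associates.mk I).factors = 0
  · rw [hc, pow_zero, pow_zero]
  · have hdvd : v.asIdeal ∣ I := (Associates.count_ne_zero_iff_dvd hI v.irreducible).mp hc
    have hv : ¬ 𝔪 ≤ v.asIdeal := fun hm =>
      (LFunctions.isCoprime_iff_forall_not_le h𝔪).mp hIm v hm (Ideal.le_of_dvd hdvd)
    rw [h v hv]

omit [IsCyclotomicExtension {3} ℚ K] in
/-- `(ψ₁ψ₂)(𝔞) = ψ₁(𝔞) ψ₂(𝔞)` (copy of `CubicRayClassCharacterCount.idealPow_mul_fun`, not imported). [folklore] -/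
private theorem idealPow_mul_fun' (ψ₁ ψ₂ : HeightOneSpectrum (𝓞 K) → ℂ) {I : Ideal (𝓞 K)} (hI : I ≠ ⊥) :
    idealPow K (fun v => ψ₁ v * ψ₂ v) I = idealPow K ψ₁ I * idealPow K ψ₂ I := by
  unfold idealPow
  rw [← finprod_mul_distrib (LFunctions.mulSupport_idealPow_finite ψ₁ hI) (LFunctions.mulSupport_idealPow_finite ψ₂ hI)]
  exact finprod_congr fun v => mul_pow _ _ _

/-- ★ **`ψ̃((b)) = (k/N(b)) · S((b)) · e(primarize b)`** for nonzero `b` prime to `36k` (`S = artinSymbol cubicLoc`, the cubic Jacobi symbol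
`(4k/b)₃`; `primarize b = u b ≡ 1 (3)`). [cite: IrelandRosen1990, Ch. 18 §6, proof of Theorem 7 (definition of `χ(A)` for `A = (α)`)] -/
theorem idealPow_psi_span {k : ℤ} (hk : k ≠ 0) (e : K →+* ℂ) {b : 𝓞 K} (hb : b ≠ 0) (hcop : IsCoprime (Ideal.span {b}) (modulus k)) :
    idealPow K (psi hζ k e) (Ideal.span {b}) =
      (J(k | Ideal.absNorm (Ideal.span {b})) : ℂ) * ((artinSymbol (cubicLoc hζ ((4 * k : ℤ) : 𝓞 K) e) (Ideal.span {b}) : ℂˣ) : ℂ) *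
        e (primarize (hsurj_three hζ) b : K) := by
  haveI : IsPrincipalIdealRing (𝓞 K) := IsCyclotomicExtension.Rat.three_pid K
  have hI : (Ideal.span {b} : Ideal (𝓞 K)) ≠ ⊥ := by rwa [Ne, Ideal.span_singleton_eq_bot]
  have h3 : IsCoprime (Ideal.span {b}) (Ideal.span {(3 : 𝓞 K)}) := by
    rw [Ideal.isCoprime_iff_sup_eq] at hcop ⊢
    refine top_le_iff.mp (hcop ▸ sup_le_sup_left ?_ _)
    exact Ideal.span_singleton_le_span_singleton.mpr ⟨((12 * k : ℤ) : 𝓞 K), by push_cast; ring⟩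
  have hS := idealPow_comp_eq (Units.coeHom ℂ) (cubicLoc hζ ((4 * k : ℤ) : 𝓞 K) e) hI
  simp only [Units.coeHom_apply] at hS
  rw [idealPow_congr_of_isCoprime' (modulus_ne_bot hk) (fun v hv => psi_of_not_mem hζ e ((modulus_le_iff k v).not.mp hv)) hI hcop,
    idealPow_mul_fun' _ _ hI, idealPow_mul_fun' _ _ hI, idealPow_jacobiSym k hI, hS]
  congr 1
  exact idealPow_primaryGen_span (hsurj_three hζ) (hinj_three hζ) (by rw [Ne, Ideal.span_singleton_eq_bot]; norm_num) e hb h3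

omit [NumberField K] [IsCyclotomicExtension {3} ℚ K] in
/-- `(36k) ⊆ (m)` for the integer divisors `m ∈ {2, 3, 4|k|, 12k}` used below, and `(36k) = (9·4k)`. [folklore] -/
private theorem modulus_le_aux (k : ℤ) :
    modulus (K := K) k ≤ Ideal.span {((2 : ℕ) : 𝓞 K)} ∧ modulus (K := K) k ≤ Ideal.span {(3 : 𝓞 K)} ∧
      modulus (K := K) k ≤ Ideal.span {((4 * k.natAbs : ℕ) : 𝓞 K)} ∧
      modulus (K := K) k ≤ Ideal.span {3 * ((4 * k : ℤ) : 𝓞 K)} ∧ modulus (K := K) k = Ideal.span {9 * ((4 * k : ℤ) : 𝓞 K)} := by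
  have hdz : ((4 * k.natAbs : ℕ) : ℤ) ∣ 36 * k :=
    ⟨9 * k.sign, by push_cast; linear_combination (-36 : ℤ) * Int.sign_mul_abs k⟩
  have h4 : ((4 * k.natAbs : ℕ) : 𝓞 K) ∣ ((36 * k : ℤ) : 𝓞 K) := by
    have := map_dvd (Int.castRingHom (𝓞 K)) hdz
    simpa only [eq_intCast, Int.cast_natCast] using this
  refine ⟨Ideal.span_singleton_le_span_singleton.mpr ⟨((18 * k : ℤ) : 𝓞 K), by push_cast; ring⟩,
    Ideal.span_singleton_le_span_singleton.mpr ⟨((12 * k : ℤ) : 𝓞 K), by push_cast; ring⟩,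
    Ideal.span_singleton_le_span_singleton.mpr h4,
    Ideal.span_singleton_le_span_singleton.mpr ⟨3, by push_cast; ring⟩, by rw [modulus]; congr 1; push_cast; ring⟩

/-- ★★ **`ψ` is a Größencharakter modulo `(36k)` of infinity type `(embType e, embTypeConj e)`** (`k ≠ 0`): `ψ(𝔭) ≠ 0` off `6k`, and for
nonzero `b ≡ c (mod 36k)` with `c` prime to `36k`, `ψ̃((b)) · e(c) = ψ̃((c)) · e(b)` — the Jacobi factor only depends on the odd norm
`N(b) ≡ N(c) (mod 4|k|)` (`jacobiSym.mod_right`), the cubic factor on `b mod 9·4k` (Artin reciprocity for `K(∛4k)/K`), and one unit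
primarises both `b` and `c` (`primarize_mul_eq_primarize_mul`).  Ireland–Rosen's Theorem 18.7: «`χ` is a Hecke character of weight one».
[cite: IrelandRosen1990, Ch. 18 §6 Theorem 7] [cite: NeukirchANT1999, Ch. VII §6 Def. (6.1)] -/
theorem isGrossencharakter_psi {k : ℤ} (hk : k ≠ 0) (e : K →+* ℂ) :
    IsGrossencharakter (modulus k) (embType e) (embTypeConj e) (psi hζ k e) := by
  haveI : IsPrincipalIdealRing (𝓞 K) := IsCyclotomicExtension.Rat.three_pid K
  obtain ⟨hle2, hle3, hle4, hle12, heq36⟩ := modulus_le_aux (K := K) k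
  have hmono : ∀ {x : 𝓞 K} {J : Ideal (𝓞 K)}, IsCoprime (Ideal.span {x}) (modulus k) → modulus k ≤ J →
      IsCoprime (Ideal.span {x}) J := fun hx hJ => by
    rw [Ideal.isCoprime_iff_sup_eq] at hx ⊢; exact top_le_iff.mp (hx ▸ sup_le_sup_left hJ _)
  refine ⟨fun v hv => psi_ne_zero hζ e ((modulus_le_iff k v).not.mp hv), fun b c hb hc hcop hbc _ => ?_⟩
  have hbcop : IsCoprime (Ideal.span {b}) (modulus k) := isCoprime_span_of_sub_mem hcop hbc
  rw [idealPow_psi_span hζ hk e hb hbcop, idealPow_psi_span hζ hk e hc hcop, prod_embedding_zpow_embType, map_div₀]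
  -- (1) the Jacobi factors agree: the norms are odd and congruent modulo `4|k|`
  have hodd : ∀ {x : 𝓞 K}, x ≠ 0 → IsCoprime (Ideal.span {x}) (modulus k) → Odd (Ideal.absNorm (Ideal.span {x})) :=
    fun hx0 hx => Nat.odd_iff.mpr (Nat.two_dvd_ne_zero.mp (not_dvd_absNorm_of_isCoprime
      (by rwa [Ne, Ideal.span_singleton_eq_bot]) Nat.prime_two (hmono hx hle2)))
  have hJ : J(k | Ideal.absNorm (Ideal.span {b})) = J(k | Ideal.absNorm (Ideal.span {c})) := by
    rw [jacobiSym.mod_right k (hodd hb hbcop), jacobiSym.mod_right k (hodd hc hcop),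
      show Ideal.absNorm (Ideal.span {b}) % (4 * k.natAbs) = Ideal.absNorm (Ideal.span {c}) % (4 * k.natAbs) from
        absNorm_span_modEq (hle4 hbc)]
  -- (2) the cubic factors agree: periodicity modulo `9 · 4k = 36k`
  have hS : (artinSymbol (cubicLoc hζ ((4 * k : ℤ) : 𝓞 K) e) (Ideal.span {b}) : ℂˣ) =
      artinSymbol (cubicLoc hζ ((4 * k : ℤ) : 𝓞 K) e) (Ideal.span {c}) :=
    artinSymbol_cubicLoc_span_eq_of_sub_mem hζ e hb hc (hmono hcop hle12) (heq36 ▸ hbc)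
  -- (3) one unit primarises `b` and `c`
  have he : e (primarize (hsurj_three hζ) b : K) * e (c : K) = e (primarize (hsurj_three hζ) c : K) * e (b : K) := by
    have h := primarize_mul_eq_primarize_mul (hsurj_three hζ) (hinj_three hζ) (hmono hcop hle3) (hle3 hbc)
    have h' : (primarize (hsurj_three hζ) b : K) * (c : K) = (primarize (hsurj_three hζ) c : K) * (b : K) := by
      exact_mod_cast congrArg (fun x : 𝓞 K => (x : K)) h
    rw [← map_mul e, ← map_mul e, h']
  have hc0 : e (c : K) ≠ 0 := by rw [map_ne_zero]; exact_mod_cast hc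
  rw [hJ, hS, mul_div_assoc', eq_div_iff hc0]
  linear_combination ((J(k | Ideal.absNorm (Ideal.span {c})) : ℂ) *
    ((artinSymbol (cubicLoc hζ ((4 * k : ℤ) : 𝓞 K) e) (Ideal.span {c}) : ℂˣ) : ℂ)) * he

/-- For `e` the embedding of an infinite place `w₀` (the only one), `embType e ≡ 1`, `embTypeConj e ≡ 0`. [cite: SilvermanATAEC1994, II Thm. 9.2 (a)] -/
private theorem embType_embedding_eq (w₀ : InfinitePlace K) :
    embType w₀.embedding = (fun _ : InfinitePlace K => (1 : ℤ)) ∧ embTypeConj w₀.embedding = (fun _ : InfinitePlace K => (0 : ℤ)) := by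
  haveI := subsingleton_infinitePlace (K := K)
  constructor
  · funext w; rw [Subsingleton.elim w w₀, embType, if_pos rfl]
  · funext w; rw [Subsingleton.elim w w₀, embTypeConj, if_pos rfl]

/-- ★★ **The literal type-`(1, 0)` form**: `IsGrossencharakter (36k) (fun _ ↦ 1) (fun _ ↦ 0) ψ` for `e` the embedding of the (unique) infinite
place — the shape of clause (i) of `Deuring_exists_heckeCharacter_of_maximalCM`. [cite: SilvermanATAEC1994, II Thm. 9.2 (a)] [cite: IrelandRosen1990, Ch. 18 §6 Theorem 7] -/
theorem isGrossencharakter_psi_one_zero {k : ℤ} (hk : k ≠ 0) (w₀ : InfinitePlace K) :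
    IsGrossencharakter (modulus k) (fun _ => 1) (fun _ => 0) (psi hζ k w₀.embedding) := by
  obtain ⟨h1, h2⟩ := embType_embedding_eq (K := K) w₀
  rw [← h1, ← h2]
  exact isGrossencharakter_psi hζ hk w₀.embedding

/-- ★ **`ψ(c • 𝔭) = conj ψ(𝔭)` for every prime** (clause (ii) of Deuring's theorem, prime by prime): the Jacobi factor is real and
`N(c𝔭) = N𝔭`, `(4k/c𝔭)₃ = conj (4k/𝔭)₃`, `ϖ_{c𝔭} = c ϖ_𝔭` and `e ∘ c = conj ∘ e`.
[cite: IrelandRosen1990, Ch. 18 §6, proof of Theorem 7 (`χ(Ā) = \overline{χ(A)}`)] [cite: SilvermanATAEC1994, II Thm. 10.5, Ex. 2.33] -/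
theorem psi_smul_eq_conj {k : ℤ} (e : K →+* ℂ) {c : K ≃ₐ[ℚ] K} (hc : c ≠ 1) (v : HeightOneSpectrum (𝓞 K)) :
    psi hζ k e (c • v) = conj (psi hζ k e v) := by
  by_cases h : ((6 * k : ℤ) : 𝓞 K) ∈ v.asIdeal
  · rw [psi_of_mem hζ e h, psi_of_mem hζ e ((intCast_mem_smul_iff c v _).mpr h), map_zero]
  · obtain ⟨-, h3, h4⟩ := not_mem_of_six_mul_not_mem h
    have h' : ((6 * k : ℤ) : 𝓞 K) ∉ (c • v).asIdeal := fun hm => h ((intCast_mem_smul_iff c v _).mp hm)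
    rw [psi_of_not_mem hζ e h, psi_of_not_mem hζ e h', map_mul, map_mul, map_intCast,
      Literature.NumberTheory.Automorphic.HeightOneSpectrum.smul_asIdeal, absNorm_smul,
      coe_cubicLoc_smul hζ e hc (smul_intCast c _) h4 h3, embedding_varpi_smul hζ e hc h3]

end Psi

end Literature.NumberTheory.GaloisRepresentations.EisensteinSextic

end
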